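import Mathlib.Analysis.Normed.Module.Connected
import Mathlib.LinearAlgebra.Complex.FiniteDimensional
import Literature.Probability.Percolation.RhombicTilingCornerConsistency
import Literature.Probability.Percolation.IsoradialUsedFaces
import Literature.Probability.LatticeModels.IsoradialDual
import HarnessLib

/-!
# Planarity of rhombic tilings, IX: the tile-adjacency graph and the dual graph are connected

Topic `Literature/Probability/Percolation`. For a preconnected graph `G` isoradially embedded with
the tiling condition and bounded angles (`PlanarTilingHyps`):

* `eq_acrossEdge_of_mem_openSegment` — **any** other rhombus containing a point of an open side
  of the rhombus of `e` is the rhombus across that side;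
* `tileReach_all` — **the rhombi are connected through shared sides**: any two edges of `G` are
  joined by a chain of edges whose consecutive rhombi share a side. (The union of the rhombi of
  a side-connected class and the union of the others are closed sets covering the plane and
  meeting only in corner points, a countable set, whose complement in the plane is connected.)
* `dualGraph_preconnected_of_used`, `dualGraph_restrictFaces_preconnected` — **the dual graph
  `G*` on the used faces is connected** (consecutive rhombi of such a chain share a face, by
  corner consistency, and the two faces of a rhombus are adjacent in `G*`): the hypothesis
  `Hconn` of `IsoradialBoxCrossingReduction`, i.e. Grimmett–Manolescu's "`G*` is the planar dual
  of `G`" (PTRF 159 (2014) = arXiv:1204.0505, §2.2 and §4.1) for the tree's rendering of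
  rhombic tilings.

## References

* G. R. Grimmett, I. Manolescu, *Bond percolation on isoradial graphs*, PTRF 159 (2014),
  arXiv:1204.0505, §2.2 (the dual graph), §4.1 (rhombic tilings).
* R. Kenyon, J.-M. Schlenker, *Rhombic embeddings of planar quad-graphs*, TAMS 357 (2005), §3.
-/

noncomputable section

open Complex ComplexConjugate Metric Set Filter Topology

namespace Literature.Probability.Percolation

open Literature.Probability.LatticeModels IsoradialCriticality

variable {V F : Type*} {G : SimpleGraph V} {emb : RhombicEmbedding G F} {ε : ℝ}

/-! ### The boundary of a parallelogram is the union of its sides -/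

section QuadBoundary

variable {A B P Q : ℂ}

/-- **Boundary points lie on sides.** A point of `conv{A, P, B, Q}` not in its interior lies on
one of the four closed sides. [folklore] -/
theorem mem_sides_of_not_mem_interior (h : IsQuad A P B Q) {Y : ℂ}
    (hY : Y ∈ convexHull ℝ ({A, P, B, Q} : Set ℂ))
    (hYi : Y ∉ interior (convexHull ℝ ({A, P, B, Q} : Set ℂ))) :
    Y ∈ segment ℝ A P ∨ Y ∈ segment ℝ P B ∨ Y ∈ segment ℝ B Q ∨ Y ∈ segment ℝ Q A := by
  have hD := h.det_ne_zero
  have hK := convexHull_quad_eq_coord h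
  have hY' := hY
  rw [hK] at hY'
  obtain ⟨⟨hα0, hα1⟩, ⟨hβ0, hβ1⟩⟩ := hY'
  set α := coordP A P Q Y with hα
  set β := coordQ A P Q Y with hβ
  have hYeq : Y = A + (α : ℂ) * (P - A) + (β : ℂ) * (Q - A) := eq_coord hD Y
  -- the open coordinate box is inside the interior
  by_cases hbox : 0 < α ∧ α < 1 ∧ 0 < β ∧ β < 1
  · exfalso
    apply hYi
    set U : Set ℂ := {Z | coordP A P Q Z ∈ Ioo (0 : ℝ) 1 ∧ coordQ A P Q Z ∈ Ioo (0 : ℝ) 1} with hU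
    have hUo : IsOpen U := (isOpen_Ioo.preimage (continuous_coordP A P Q)).inter
      (isOpen_Ioo.preimage (continuous_coordQ A P Q))
    have hUK : U ⊆ convexHull ℝ ({A, P, B, Q} : Set ℂ) := by
      rw [hK]; rintro Z ⟨⟨h1, h2⟩, ⟨h3, h4⟩⟩; exact ⟨⟨h1.le, h2.le⟩, ⟨h3.le, h4.le⟩⟩
    exact interior_maximal hUK hUo ⟨⟨hbox.1, hbox.2.1⟩, ⟨hbox.2.2.1, hbox.2.2.2⟩⟩
  · -- some coordinate is `0` or `1`
    have hB : B = A + (P - A) + (Q - A) := h.B_eq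
    push Not at hbox
    by_cases ha0 : α = 0
    · -- side `[Q, A]`: `Y = A + β (Q - A)`
      right; right; right
      rw [segment_symm, segment_eq_image]
      refine ⟨β, ⟨hβ0, hβ1⟩, ?_⟩
      rw [hYeq, ha0]; simp only [Complex.real_smul]; push_cast; ring
    by_cases ha1 : α = 1
    · -- side `[P, B]`: `Y = P + β (Q - A) = P + β (B - P)`
      right; left
      rw [segment_eq_image]
      refine ⟨β, ⟨hβ0, hβ1⟩, ?_⟩
      rw [hYeq, ha1, hB]; simp only [Complex.real_smul]; push_cast; ring
    have hα0' : 0 < α := lt_of_le_of_ne hα0 (Ne.symm ha0)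
    have hα1' : α < 1 := lt_of_le_of_ne hα1 ha1
    by_cases hb0 : β = 0
    · left
      rw [segment_eq_image]
      refine ⟨α, ⟨hα0, hα1⟩, ?_⟩
      rw [hYeq, hb0]; simp only [Complex.real_smul]; push_cast; ring
    have hb1 : β = 1 := by
      by_contra hb1
      exact absurd (hbox hα0' hα1' (lt_of_le_of_ne hβ0 (Ne.symm hb0))) (not_le.2 (lt_of_le_of_ne hβ1 hb1))
    -- side `[B, Q]`: `Y = Q + α (P - A) = Q + α (B - Q)`
    right; right; left
    rw [segment_symm, segment_eq_image]
    refine ⟨α, ⟨hα0, hα1⟩, ?_⟩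
    rw [hYeq, hb1, hB]; simp only [Complex.real_smul]; push_cast; ring

end QuadBoundary

variable [DecidableEq V] [DecidableEq F]

/-! ### Any rhombus across a side is the rhombus across it -/

/-- A point of the rhombus of `d` that is not interior lies on one of its four closed sides
`[z v, c f]`, `(v, f) ∈ dartSides d`. [folklore] -/
theorem exists_mem_segment_side_of_not_mem_interior (hiso : emb.IsIsoradial) (d : G.Dart) {Y : ℂ}
    (hY : Y ∈ emb.rhombus ⟨d.edge, d.edge_mem⟩) (hYi : Y ∉ interior (emb.rhombus ⟨d.edge, d.edge_mem⟩)) :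
    ∃ p ∈ emb.dartSides d, Y ∈ segment ℝ (emb.z p.1) (emb.c p.2) := by
  rw [rhombus_dart_eq hiso d] at hY hYi
  rcases mem_sides_of_not_mem_interior (dart_isQuad hiso d) hY hYi with h | h | h | h
  · exact ⟨(d.fst, emb.leftFace d), (mem_dartSides_iff d _).2 (Or.inl rfl), h⟩
  · exact ⟨(d.snd, emb.leftFace d), (mem_dartSides_iff d _).2 (Or.inr (Or.inl rfl)),
      by rw [segment_symm]; exact h⟩
  · exact ⟨(d.snd, emb.rightFace d), (mem_dartSides_iff d _).2 (Or.inr (Or.inr (Or.inl rfl))), h⟩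
  · exact ⟨(d.fst, emb.rightFace d), (mem_dartSides_iff d _).2 (Or.inr (Or.inr (Or.inr rfl))),
      by rw [segment_symm]; exact h⟩

/-- An interior point of a set contained in a closed half-plane `{0 ≤ s · g}` lies in the open
half-plane `{0 < s · g}`. [folklore] -/
theorem sideFn_pos_of_mem_interior {S₀ S₁ : ℂ} (hS : S₀ ≠ S₁) {s : ℝ} (hs : s ≠ 0) {K : Set ℂ}
    (hK : K ⊆ {Y | 0 ≤ s * sideFn S₀ S₁ Y}) {Y : ℂ} (hY : Y ∈ interior K) :
    0 < s * sideFn S₀ S₁ Y := by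
  have h0 : 0 ≤ s * sideFn S₀ S₁ Y := hK (interior_subset hY)
  rcases h0.lt_or_eq with h | h
  · exact h
  · exfalso
    obtain ⟨r, hr, hsub⟩ := Metric.isOpen_iff.1 isOpen_interior Y hY
    have hn : 0 < ‖S₁ - S₀‖ := norm_pos_iff.2 (sub_ne_zero.2 hS.symm)
    -- move against the gradient of `s · g`
    set ρ : ℝ := r / (2 * (|s| + 1) * ‖S₁ - S₀‖) with hρ
    have hρpos : 0 < ρ := by positivity
    set Y' : ℂ := Y + ((-s * ρ : ℝ) : ℂ) * (I * (S₁ - S₀)) with hY'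
    have hw : (I * (S₁ - S₀) * conj (S₁ - S₀)).im = ‖S₁ - S₀‖ ^ 2 := by
      rw [mul_assoc, Complex.mul_conj, Complex.normSq_eq_norm_sq, Complex.I_mul_im, Complex.ofReal_re]
    have hneg : s * sideFn S₀ S₁ Y' < 0 := by
      have hg' : s * sideFn S₀ S₁ Y' = -(s * s) * ρ * ‖S₁ - S₀‖ ^ 2 := by
        rw [hY', sideFn_add_smul, hw, mul_add, h.symm, zero_add]; ring
      rw [hg']
      have hss : 0 < s * s := mul_self_pos.2 hs
      have : 0 < (s * s) * ρ * ‖S₁ - S₀‖ ^ 2 := by positivity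
      linarith
    have hdist : Y' ∈ ball Y r := by
      rw [mem_ball, dist_eq_norm]
      have : Y' - Y = ((-s * ρ : ℝ) : ℂ) * (I * (S₁ - S₀)) := by rw [hY']; ring
      rw [this, norm_mul, norm_mul, Complex.norm_I, one_mul, Complex.norm_real, Real.norm_eq_abs,
        abs_mul, abs_neg, abs_of_pos hρpos, hρ]
      have h2 : |s| * (r / (2 * (|s| + 1) * ‖S₁ - S₀‖)) * ‖S₁ - S₀‖ = (|s| / (|s| + 1)) * (r / 2) := by
        field_simp
      rw [h2]
      have h3 : |s| / (|s| + 1) < 1 := by rw [div_lt_one (by positivity)]; linarith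
      calc |s| / (|s| + 1) * (r / 2) < 1 * (r / 2) := mul_lt_mul_of_pos_right h3 (by linarith)
        _ < r := by linarith
    have := hK (interior_subset (hsub hdist))
    simp only [mem_setOf_eq] at this
    linarith

/-- **Any other rhombus containing a point of an open side is the rhombus across that side.**
[cite: GrimmettManolescu2014Isoradial, §4.1 (each side of a rhombus is shared with exactly one other rhombus)] -/
theorem eq_acrossEdge_of_mem_openSegment (H : PlanarTilingHyps emb ε) (e e' : G.edgeSet) (hne : e' ≠ e)
    {p : V × F} (hp : p ∈ emb.sides e) {X : ℂ} (hX : X ∈ openSegment ℝ (emb.z p.1) (emb.c p.2))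
    (hXe' : X ∈ emb.rhombus e') : e' = acrossEdge H e p := by
  have hiso := H.iso
  set d := RhombicEmbedding.refDart e with hd
  set d' := RhombicEmbedding.refDart e' with hd'
  have hde : (⟨d.edge, d.edge_mem⟩ : G.edgeSet) = e := Subtype.ext (RhombicEmbedding.refDart_edge e)
  have hde' : (⟨d'.edge, d'.edge_mem⟩ : G.edgeSet) = e' := Subtype.ext (RhombicEmbedding.refDart_edge e')
  have hned : d'.edge ≠ d.edge := by
    intro h; apply hne; rw [← hde, ← hde']; exact Subtype.ext h
  change p ∈ emb.dartSides d at hp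
  set U := acrossEdge H e p with hU
  obtain ⟨p', hp', hs'⟩ := exists_side_acrossEdge H e hp
  set dU := RhombicEmbedding.refDart U with hdU
  have hdUe : (⟨dU.edge, dU.edge_mem⟩ : G.edgeSet) = U := Subtype.ext (RhombicEmbedding.refDart_edge U)
  change p' ∈ emb.dartSides dU at hp'
  -- the line of the side, the sign of `e`
  set S₀ := emb.z p.1 with hS₀
  set S₁ := emb.c p.2 with hS₁
  have hS : S₀ ≠ S₁ := z_ne_c_of_mem_dartSides hiso d hp
  set s := sideFn S₀ S₁ (emb.dartCentre d) with hs_def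
  have hs : s ≠ 0 := sideFn_dartCentre_ne_zero hiso d hp
  have hT : emb.rhombus ⟨d.edge, d.edge_mem⟩ ⊆ {Y | 0 ≤ s * sideFn S₀ S₁ Y} :=
    FaultLine.rhombus_subset_halfPlane_self hiso hp
  obtain ⟨-, -, hconv3⟩ := FaultLine.halfPlane_conv hiso hS hs hT hp (sideFn_left _ _) (sideFn_right _ _)
  -- `U` lies in `H(-s)`, has the side on the line, and half-discs at `X`
  have hXU : X ∈ openSegment ℝ (emb.z p'.1) (emb.c p'.2) := by
    rw [FaultLine.openSegment_eq_of_pair_eq hs']; exact hX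
  have hXUmem : X ∈ emb.rhombus ⟨dU.edge, dU.edge_mem⟩ :=
    FaultLine.segment_side_subset_rhombus hiso hp' (openSegment_subset_segment ℝ _ _ hXU)
  have hUne : dU.edge ≠ d.edge := by
    intro h
    have : U = e := by rw [← hdUe, ← hde]; exact Subtype.ext h
    exact acrossEdge_ne H e hp this
  have hUout : emb.rhombus ⟨dU.edge, dU.edge_mem⟩ ⊆ {Y | 0 ≤ -s * sideFn S₀ S₁ Y} :=
    (rhombus_subset_sideOuter hiso H.tiling d dU hUne hp hX hXUmem).trans hconv3
  have hg1 : sideFn S₀ S₁ (emb.z p'.1) = 0 := by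
    have : emb.z p'.1 ∈ ({S₀, S₁} : Set ℂ) := by rw [← hs']; simp
    rcases this with h | h
    · rw [h, sideFn_left]
    · rw [mem_singleton_iff] at h; rw [h, sideFn_right]
  have hg2 : sideFn S₀ S₁ (emb.c p'.2) = 0 := by
    have : emb.c p'.2 ∈ ({S₀, S₁} : Set ℂ) := by rw [← hs']; simp
    rcases this with h | h
    · rw [h, sideFn_left]
    · rw [mem_singleton_iff] at h; rw [h, sideFn_right]
  obtain ⟨-, hconv2, -⟩ := FaultLine.halfPlane_conv hiso hS (neg_ne_zero.2 hs) hUout hp' hg1 hg2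
  obtain ⟨r, hr, -, hint⟩ := exists_ball_inter_sideInner_subset hiso dU hp' hXU
  -- `e'` lies in `H(-s)` too; an interior point of it near `X` is interior to `U`
  have hXe'd : X ∈ emb.rhombus ⟨d'.edge, d'.edge_mem⟩ := by rw [hde']; exact hXe'
  have he'out : emb.rhombus ⟨d'.edge, d'.edge_mem⟩ ⊆ {Y | 0 ≤ -s * sideFn S₀ S₁ Y} :=
    (rhombus_subset_sideOuter hiso H.tiling d d' hned hp hX hXe'd).trans hconv3
  have hq' := dart_isQuad hiso d'
  have hK' := rhombus_dart_eq hiso d'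
  have hcl : X ∈ closure (interior (emb.rhombus ⟨d'.edge, d'.edge_mem⟩)) := by
    rw [hK'] at hXe'd ⊢; exact subset_closure_interior_quad hq' hXe'd
  rw [Metric.mem_closure_iff] at hcl
  obtain ⟨Y, hYint, hYdist⟩ := hcl r hr
  have hYpos : 0 < -s * sideFn S₀ S₁ Y := sideFn_pos_of_mem_interior hS (neg_ne_zero.2 hs) he'out hYint
  have hYU : Y ∈ interior (emb.rhombus ⟨dU.edge, dU.edge_mem⟩) :=
    hint ⟨by rw [mem_ball, dist_comm]; exact hYdist, hconv2 hYpos⟩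
  -- so the interiors of `e'` and `U` meet
  by_contra hcon
  have hne2 : (⟨d'.edge, d'.edge_mem⟩ : G.edgeSet) ≠ ⟨dU.edge, dU.edge_mem⟩ := by
    rw [hde', hdUe]; exact hcon
  exact Set.disjoint_left.1 (H.tiling.disjoint_interior hne2) hYint hYU

/-! ### The rhombi are connected through shared sides -/

/-- **Tile adjacency**: the rhombus of `e'` is across a side of the rhombus of `e`. [cite: GrimmettManolescu2014Isoradial, §4.1 (rhombic tilings of the plane)] -/
def TileAdj (H : PlanarTilingHyps emb ε) (e e' : G.edgeSet) : Prop :=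
  ∃ p ∈ emb.sides e, e' = acrossEdge H e p

/-- Tile adjacency is symmetric. [folklore] -/
theorem TileAdj.symm (H : PlanarTilingHyps emb ε) {e e' : G.edgeSet} (h : TileAdj H e e') :
    TileAdj H e' e := by
  obtain ⟨p, hp, rfl⟩ := h
  obtain ⟨p', hp', hs'⟩ := exists_side_acrossEdge H e hp
  exact ⟨p', hp', (acrossEdge_acrossEdge H e hp hp' hs').symm⟩

omit [DecidableEq V] [DecidableEq F] in
/-- The family of rhombi is locally finite. [cite: GrimmettManolescu2014Isoradial, §4.1 and §4.4 Prop. 7] -/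
theorem locallyFinite_rhombus (H : PlanarTilingHyps emb ε) :
    LocallyFinite fun e : G.edgeSet => emb.rhombus e := by
  intro Y
  refine ⟨closedBall Y 1, Metric.closedBall_mem_nhds Y one_pos, ?_⟩
  exact finite_setOf_rhombus_inter_closedBall H.iso H.tiling H.bap H.pos Y 1

omit [DecidableEq V] [DecidableEq F] in
/-- Rhombi are closed. [folklore] -/
theorem isClosed_rhombus_edge (e : G.edgeSet) : IsClosed (emb.rhombus e) := by
  unfold RhombicEmbedding.rhombus; exact isClosed_quad _ _ _ _

omit [DecidableEq V] [DecidableEq F] in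
/-- **The set of all corner points is countable** (finitely many rhombi meet each disc).
[cite: GrimmettManolescu2014Isoradial, §4.4 Prop. 7 (local finiteness)] -/
theorem countable_corners (H : PlanarTilingHyps emb ε) :
    (⋃ d : G.Dart, Parity.cornerSet emb d).Countable := by
  have hcov : (⋃ d : G.Dart, Parity.cornerSet emb d) ⊆
      ⋃ n : ℕ, ⋃ e ∈ {e : G.edgeSet | (emb.rhombus e ∩ closedBall 0 n).Nonempty},
        Parity.cornerSet emb (RhombicEmbedding.refDart e) := by
    intro X hX
    obtain ⟨d, hd⟩ := mem_iUnion.1 hX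
    obtain ⟨n, hn⟩ := exists_nat_ge ‖X‖
    refine mem_iUnion.2 ⟨n, mem_biUnion (x := (⟨d.edge, d.edge_mem⟩ : G.edgeSet)) ?_ ?_⟩
    · refine ⟨X, Parity.cornerSet_subset_rhombus H.iso d hd, ?_⟩
      rw [mem_closedBall, dist_zero_right]; exact hn
    · rw [Parity.cornerSet_eq_of_edge_eq H.iso
        (RhombicEmbedding.refDart_edge ⟨d.edge, d.edge_mem⟩ : (RhombicEmbedding.refDart _).edge = d.edge)]
      exact hd
  refine Set.Countable.mono hcov (Set.countable_iUnion fun n => ?_)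
  refine Set.Finite.countable ?_
  refine (finite_setOf_rhombus_inter_closedBall H.iso H.tiling H.bap H.pos 0 n).biUnion fun e _ => ?_
  unfold Parity.cornerSet
  exact Set.toFinite _

omit [DecidableEq V] [DecidableEq F] in
/-- Corner points are not interior to any rhombus. [folklore] -/
theorem not_mem_interior_of_mem_cornerSet (hiso : emb.IsIsoradial) (hrh : emb.IsRhombicTiling)
    {d : G.Dart} {X : ℂ} (hX : X ∈ Parity.cornerSet emb d) (e : G.edgeSet) :
    X ∉ interior (emb.rhombus e) := by
  rcases (Parity.mem_cornerSet_iff d X).1 hX with rfl | rfl | rfl | rfl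
  · exact z_fst_not_mem_interior_rhombus hiso hrh d e
  · exact c_leftFace_not_mem_interior_rhombus hiso hrh d e
  · exact z_fst_not_mem_interior_rhombus hiso hrh d.symm e
  · exact c_rightFace_not_mem_interior_rhombus hiso hrh d e

/-- **A common point of two rhombi that are neither equal nor adjacent is a corner point.**
[cite: GrimmettManolescu2014Isoradial, §4.1 (rhombic tilings of the plane)] -/
theorem mem_corners_of_mem_inter (H : PlanarTilingHyps emb ε) {e e' : G.edgeSet} (hne : e' ≠ e)
    (hnadj : ¬ TileAdj H e e') {X : ℂ} (hX : X ∈ emb.rhombus e) (hX' : X ∈ emb.rhombus e') :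
    X ∈ ⋃ d : G.Dart, Parity.cornerSet emb d := by
  have hiso := H.iso
  set d := RhombicEmbedding.refDart e with hd
  have hde : (⟨d.edge, d.edge_mem⟩ : G.edgeSet) = e := Subtype.ext (RhombicEmbedding.refDart_edge e)
  rw [← hde] at hX
  -- `X` is not interior to `e`
  have hXi : X ∉ interior (emb.rhombus ⟨d.edge, d.edge_mem⟩) := by
    intro hXi
    set d' := RhombicEmbedding.refDart e' with hd'
    have hde' : (⟨d'.edge, d'.edge_mem⟩ : G.edgeSet) = e' := Subtype.ext (RhombicEmbedding.refDart_edge e')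
    rw [← hde', rhombus_dart_eq hiso d'] at hX'
    have hmeet := interior_inter_nonempty (dart_isQuad hiso d') hX' hXi
    rw [← rhombus_dart_eq hiso d', hde', hde] at hmeet
    exact Set.not_nonempty_iff_eq_empty.2
      (Set.disjoint_iff_inter_eq_empty.1 (H.tiling.disjoint_interior hne)) hmeet
  obtain ⟨p, hp, hXp⟩ := exists_mem_segment_side_of_not_mem_interior hiso d hX hXi
  rcases Mesh.eq_or_eq_or_mem_openSegment hXp with h | h | hopen
  · exact mem_iUnion.2 ⟨d, (Parity.mem_cornerSet_iff d X).2 (FaultLine.corner_of_mem_dartSides hp (Or.inl h))⟩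
  · exact mem_iUnion.2 ⟨d, (Parity.mem_cornerSet_iff d X).2 (FaultLine.corner_of_mem_dartSides hp (Or.inr h))⟩
  · exfalso
    exact hnadj ⟨p, hp, eq_acrossEdge_of_mem_openSegment H e e' hne hp hopen hX'⟩

/-- **The rhombi are connected through shared sides.** [cite: GrimmettManolescu2014Isoradial, §4.1 (the diamond graph is a connected planar graph)] -/
theorem tileReach_all (H : PlanarTilingHyps emb ε) (e₀ e₁ : G.edgeSet) :
    Relation.ReflTransGen (TileAdj H) e₀ e₁ := by
  by_contra hnot
  have hiso := H.iso
  set C : Set G.edgeSet := {e | Relation.ReflTransGen (TileAdj H) e₀ e} with hC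
  have hC_closed : ∀ {e e'}, e ∈ C → TileAdj H e e' → e' ∈ C := fun he h => he.tail h
  set K₁ : Set ℂ := ⋃ e : C, emb.rhombus (e : G.edgeSet) with hK₁
  set K₂ : Set ℂ := ⋃ e : (Cᶜ : Set G.edgeSet), emb.rhombus (e : G.edgeSet) with hK₂
  have hlf := locallyFinite_rhombus H
  have hK₁c : IsClosed K₁ :=
    (hlf.comp_injective Subtype.val_injective).isClosed_iUnion fun e => isClosed_rhombus_edge _
  have hK₂c : IsClosed K₂ :=
    (hlf.comp_injective Subtype.val_injective).isClosed_iUnion fun e => isClosed_rhombus_edge _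
  have hcov : K₁ ∪ K₂ = univ := by
    apply eq_univ_of_forall
    intro X
    have : X ∈ ⋃ e : G.edgeSet, emb.rhombus e := by rw [H.tiling.iUnion_rhombus]; trivial
    obtain ⟨e, he⟩ := mem_iUnion.1 this
    by_cases hC' : e ∈ C
    · exact Or.inl (mem_iUnion.2 ⟨⟨e, hC'⟩, he⟩)
    · exact Or.inr (mem_iUnion.2 ⟨⟨e, hC'⟩, he⟩)
  set S : Set ℂ := ⋃ d : G.Dart, Parity.cornerSet emb d with hS
  have hScount : S.Countable := countable_corners H
  have hinter : K₁ ∩ K₂ ⊆ S := by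
    rintro X ⟨h1, h2⟩
    obtain ⟨⟨e, he⟩, hXe⟩ := mem_iUnion.1 h1
    obtain ⟨⟨e', he'⟩, hXe'⟩ := mem_iUnion.1 h2
    have hne : e' ≠ e := fun h => he' (h ▸ he)
    have hnadj : ¬ TileAdj H e e' := fun h => he' (hC_closed he h)
    exact mem_corners_of_mem_inter H hne hnadj hXe hXe'
  -- the complement of `S` is connected, and meets both `K₁` and `K₂`
  have hconn : IsPreconnected Sᶜ :=
    (hScount.isPathConnected_compl_of_one_lt_rank (by rw [Complex.rank_real_complex]; norm_num)).isConnected.isPreconnected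
  have hint : ∀ e : G.edgeSet, ∃ X ∈ interior (emb.rhombus e), X ∉ S := by
    intro e
    set d := RhombicEmbedding.refDart e
    have hde : (⟨d.edge, d.edge_mem⟩ : G.edgeSet) = e := Subtype.ext (RhombicEmbedding.refDart_edge e)
    refine ⟨emb.dartCentre d, ?_, ?_⟩
    · rw [← hde, rhombus_dart_eq hiso d]; exact centre_mem_interior_quad (dart_isQuad hiso d)
    · intro hXS
      obtain ⟨d', hd'⟩ := mem_iUnion.1 hXS
      apply not_mem_interior_of_mem_cornerSet hiso H.tiling hd' e
      rw [← hde, rhombus_dart_eq hiso d]; exact centre_mem_interior_quad (dart_isQuad hiso d)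
  have h1 : (Sᶜ ∩ K₁).Nonempty := by
    obtain ⟨X, hX, hXS⟩ := hint e₀
    exact ⟨X, hXS, mem_iUnion.2 ⟨⟨e₀, Relation.ReflTransGen.refl⟩, interior_subset hX⟩⟩
  have h2 : (Sᶜ ∩ K₂).Nonempty := by
    obtain ⟨X, hX, hXS⟩ := hint e₁
    exact ⟨X, hXS, mem_iUnion.2 ⟨⟨e₁, hnot⟩, interior_subset hX⟩⟩
  obtain ⟨X, hXS, hX12⟩ := (isPreconnected_closed_iff.1 hconn) K₁ K₂ hK₁c hK₂c
    (by rw [hcov]; exact subset_univ _) h1 h2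
  exact hXS (hinter hX12)

/-! ### The dual graph is connected -/

/-- The faces of an edge: the second components of its sides. [folklore] -/
theorem snd_mem_faces (e : G.edgeSet) {p : V × F} (hp : p ∈ emb.sides e) :
    p.2 = emb.leftFace (RhombicEmbedding.refDart e) ∨ p.2 = emb.rightFace (RhombicEmbedding.refDart e) := by
  change p ∈ emb.dartSides (RhombicEmbedding.refDart e) at hp
  rcases (mem_dartSides_iff _ p).1 hp with rfl | rfl | rfl | rfl <;> simp

omit [DecidableEq V] [DecidableEq F] in
/-- The two faces of an edge are joined in the dual graph. [cite: GrimmettManolescu2014Isoradial, §2.2 (the dual graph G*)] -/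
theorem dual_reachable_faces (hiso : emb.IsIsoradial) (e : G.edgeSet) {f g : F}
    (hf : f = emb.leftFace (RhombicEmbedding.refDart e) ∨ f = emb.rightFace (RhombicEmbedding.refDart e))
    (hg : g = emb.leftFace (RhombicEmbedding.refDart e) ∨ g = emb.rightFace (RhombicEmbedding.refDart e)) :
    emb.dualGraph.Reachable f g := by
  set d := RhombicEmbedding.refDart e
  have hne : emb.leftFace d ≠ emb.rightFace d := fun h => hiso.c_leftFace_ne d (congrArg emb.c h)
  have hadj : emb.dualGraph.Adj (emb.leftFace d) (emb.rightFace d) := emb.dualGraph_adj_leftFace_rightFace hne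
  rcases hf with rfl | rfl <;> rcases hg with rfl | rfl
  · exact SimpleGraph.Reachable.refl _
  · exact hadj.reachable
  · exact hadj.symm.reachable
  · exact SimpleGraph.Reachable.refl _

/-- **Adjacent rhombi share a face** (corner consistency: the shared side has the same labels).
[cite: GrimmettManolescu2014Isoradial, §4.1 (G^◇ is bipartite with vertex set V ∪ V*)] -/
theorem exists_common_face (H : PlanarTilingHyps emb ε) {e e' : G.edgeSet} (h : TileAdj H e e') :
    ∃ f : F, (f = emb.leftFace (RhombicEmbedding.refDart e) ∨ f = emb.rightFace (RhombicEmbedding.refDart e)) ∧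
      (f = emb.leftFace (RhombicEmbedding.refDart e') ∨ f = emb.rightFace (RhombicEmbedding.refDart e')) := by
  obtain ⟨p, hp, rfl⟩ := h
  obtain ⟨p', hp', hs'⟩ := exists_side_acrossEdge H e hp
  refine ⟨p.2, snd_mem_faces e hp, ?_⟩
  -- the labels of the shared side agree
  have hc : emb.c p'.2 = emb.c p.2 := by
    have hmem : emb.c p'.2 ∈ ({emb.z p.1, emb.c p.2} : Set ℂ) := by rw [← hs']; simp
    rcases hmem with h | h
    · exfalso
      -- `c p'.2 = z p.1`: a clash
      rcases snd_mem_faces _ hp' with h2 | h2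
      · exact z_ne_c_leftFace H p.1 (RhombicEmbedding.refDart _) (by rw [← h2]; exact h.symm)
      · exact z_ne_c_leftFace H p.1 (RhombicEmbedding.refDart _).symm
          (by rw [H.iso.leftFace_symm, ← h2]; exact h.symm)
    · exact h
  have : p'.2 = p.2 := H.tiling.c_injective hc
  rw [← this]
  exact snd_mem_faces _ hp'

/-- **The dual graph is connected on the used faces**: if every face is a face of some dart, the
dual graph is preconnected. [cite: GrimmettManolescu2014Isoradial, §2.2 and §4.1 (G* is the planar dual of the connected plane graph G)] -/
theorem dualGraph_preconnected_of_used (H : PlanarTilingHyps emb ε)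
    (hused : ∀ f : F, ∃ d : G.Dart, emb.leftFace d = f ∨ emb.rightFace d = f) :
    emb.dualGraph.Preconnected := by
  have hiso := H.iso
  -- faces of an edge are dual-reachable from faces of any tile-reachable edge
  have key : ∀ {e e' : G.edgeSet}, Relation.ReflTransGen (TileAdj H) e e' → ∀ {f g : F},
      (f = emb.leftFace (RhombicEmbedding.refDart e) ∨ f = emb.rightFace (RhombicEmbedding.refDart e)) →
      (g = emb.leftFace (RhombicEmbedding.refDart e') ∨ g = emb.rightFace (RhombicEmbedding.refDart e')) →
      emb.dualGraph.Reachable f g := by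
    intro e e' h
    induction h with
    | refl => intro f g hf hg; exact dual_reachable_faces hiso e hf hg
    | @tail b c _ hbc ih =>
      intro f g hf hg
      obtain ⟨φ, hφb, hφc⟩ := exists_common_face H hbc
      exact (ih hf hφb).trans (dual_reachable_faces hiso c hφc hg)
  -- a face of a dart is a face of the reference dart of its edge
  have hface : ∀ {f : F} {d : G.Dart}, (emb.leftFace d = f ∨ emb.rightFace d = f) →
      f = emb.leftFace (RhombicEmbedding.refDart ⟨d.edge, d.edge_mem⟩) ∨
        f = emb.rightFace (RhombicEmbedding.refDart ⟨d.edge, d.edge_mem⟩) := by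
    intro f d hf
    set d' := RhombicEmbedding.refDart (⟨d.edge, d.edge_mem⟩ : G.edgeSet) with hd'
    have hdd' : d'.edge = d.edge := RhombicEmbedding.refDart_edge _
    rcases (SimpleGraph.dart_edge_eq_iff d' d).1 hdd' with h | h
    · rw [h]; rcases hf with rfl | rfl
      · exact Or.inl rfl
      · exact Or.inr rfl
    · rw [h, hiso.leftFace_symm]
      have hr : emb.rightFace d.symm = emb.leftFace d := by
        rw [← hiso.leftFace_symm d.symm, SimpleGraph.Dart.symm_symm]
      rw [hr]; rcases hf with rfl | rfl
      · exact Or.inr rfl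
      · exact Or.inl rfl
  intro f g
  obtain ⟨d, hd⟩ := hused f
  obtain ⟨d', hd'⟩ := hused g
  exact key (tileReach_all H ⟨d.edge, d.edge_mem⟩ ⟨d'.edge, d'.edge_mem⟩) (hface hd) (hface hd')

/-- **`Hconn`**: the dual graph of the restriction to the used faces is preconnected.
[cite: GrimmettManolescu2014Isoradial, §2.2 and §4.1 (G* is the planar dual of the connected plane graph G)] -/
theorem dualGraph_restrictFaces_preconnected (hconn : G.Preconnected) (hiso : emb.IsIsoradial)
    (hrh : emb.IsRhombicTiling) (hbap : emb.HasBoundedAngles ε) (hε : 0 < ε) :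
    emb.restrictFaces.dualGraph.Preconnected := by
  classical
  have H' : PlanarTilingHyps emb.restrictFaces ε :=
    ⟨hconn, hiso.restrictFaces, hrh.restrictFaces, hbap.restrictFaces, hε⟩
  apply dualGraph_preconnected_of_used H'
  rintro ⟨f, d, hd⟩
  refine ⟨d, ?_⟩
  rcases hd with h | h
  · left; exact Subtype.ext h
  · right; exact Subtype.ext h

end Literature.Probability.Percolation

end
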